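import Summits.ValiantsHypothesis.ValiantsHypothesis.Theorems.GeneratorObstructionsPerGenDegreeSuperQPModularCollapse
import Mathlib.Analysis.Convex.Birkhoff

/-!
# Route GeneratorObstructions — K1 `PerGenDegreeSuperQP` (stmt-ValiantsHypothesis-11654),
# line `per-side-atoms`: the modular collapse `Q_{m,j}` is POLYSTABLE for every `1 ≤ j ≤ m`
# (positive cone via a flat strictly positive coupling and Birkhoff–von Neumann)

Sequel of `…ModularCollapse` (the form `Q_{m,j} = ∑_σ ∏_i y_{(σ i + i) mod j}` and its separating
torus). Here hypothesis (2) of the corrected BI 2017 Prop. 2.8 — rational `c_α > 0` on ALL of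
`supp Q_{m,j}` with `∑_α c_α α = (1,…,1)` — is produced. Uniform weights (`c_α ∝` coefficient, the
device of all earlier collapse files) give the residue counts `#{(i,k) : i + k ≡ r}`, which are flat
only when `j ∣ m²`; the new device:

* `exists_pos_weights_of_pos_doublyStochastic` — a doubly stochastic matrix with all entries
  POSITIVE is a mixture of permutation matrices with ALL `m!` weights positive (Birkhoff–von Neumann
  from Mathlib, `exists_eq_sum_perm_of_mem_doublyStochastic`, applied to `M - μJ` and re-mixed with
  the uniform measure `J = ∑_σ P_σ / #{σ : σ i₀ = i₀}`);
* `exists_flat_pos_coupling` — for `1 ≤ j ≤ m`, with `A_s = #{i < m : i ≡ s (mod j)}` (all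
  `≥ ⌊m/j⌋ ≥ 1`), the matrix `M_{ii'} = P_{ρ i, ρ i'} / (A_{ρ i} A_{ρ i'})`,
  `P_{st} = (A_s + A_t)/j - m/j²` (`ρ i = i mod j`), is doubly stochastic with positive entries and
  its residue profile `∑_{ρ i' + ρ i = r} M_{ii'} = ∑_s P_{s, r-s} = m/j` is FLAT
  (`P_{st} > 0 ⟺ j(A_s + A_t) > m`, true as `2j⌊m/j⌋ > m`);
* `modCollapse_posCone` — hence weights `w_σ > 0` with `∑_σ w_σ [σ i = i'] = M_{ii'}`, and
  `c_α := (j/m) ∑_{e_σ = α} w_σ` is positive on the support with `∑_α c_α α_r = 1` for every `r`;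
* `isPolystable_modCollapse` — **`Q_{m,j}` is polystable for all `1 ≤ j ≤ m`**
  (`isPolystable_of_separating_diagonalStabilizers`).

The sequel `…ModularCollapseRays` places `Q_{m,j}` inside `Δ(per_m)`: every chamber ray `(1^j)^*`,
`1 ≤ j ≤ m`, of `S(per_m)` is hit and starts with an atom. Honest framing: unconditional occupancy
theorems; `stub_atomLate` (`c ≥ 2`), K1, `GenFlipThesis` remain OPEN; nothing bears on VP vs VNP.
References: [BurgisserIkenmeyer2017] Prop. 2.8 (corrected, tree erratum A31), Cor. 2.9;
G. Birkhoff (1946) via Mathlib `doublyStochastic_eq_convexHull_permMatrix`. [folklore]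
-/

set_option linter.dupNamespace false

noncomputable section

namespace Summit.ValiantsHypothesis.ValiantsHypothesis.Theorems.GeneratorObstructions.PerGenDegreeSuperQP

open MvPolynomial
open Literature.NumberTheory.DiophantineGeometry Literature.Computability.AlgebraicComplexity
  Literature.Computability.Complexity

/-! ### 1. Positive doubly stochastic matrices are full-support mixtures of permutations -/

section Mixture

variable {m : ℕ}

/-- The `(i, i')` entry of the permutation matrix of `σ` is the indicator of `σ i = i'`.
[folklore] -/
theorem permMatrix_apply_eq_ite (σ : Equiv.Perm (Fin m)) (i i' : Fin m) :
    σ.permMatrix ℚ i i' = if σ i = i' then 1 else 0 := by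
  unfold Equiv.Perm.permMatrix
  rw [PEquiv.toMatrix_toPEquiv_apply, Pi.single_apply]
  exact if_congr eq_comm rfl rfl

/-- **Positive doubly stochastic matrices are FULL-SUPPORT mixtures of permutation matrices**:
if `M` is doubly stochastic with all entries `> 0` there are weights `w_σ > 0` for ALL permutations
`σ` with `∑_σ w_σ [σ i = i'] = M_{i i'}`. Proof: `2μ := min M`; `M - μJ` has nonnegative entries
and constant line sums `1 - mμ ≥ 0`, so it is `(1 - mμ) · M'` with `M'` doubly stochastic
(Mathlib `exists_mem_doublyStochastic_eq_smul_iff`); Birkhoff–von Neumann writes `M'` as a convex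
combination `∑ π_σ P_σ`; and `μ J = (μ/S) ∑_σ P_σ` with `S = #{σ : σ i₀ = i₀}`; take
`w_σ = (1 - mμ) π_σ + μ/S`. [folklore] -/
theorem exists_pos_weights_of_pos_doublyStochastic (M : Matrix (Fin m) (Fin m) ℚ)
    (hpos : ∀ i i', 0 < M i i') (hrow : ∀ i, ∑ i', M i i' = 1) (hcol : ∀ i', ∑ i, M i i' = 1) :
    ∃ w : Equiv.Perm (Fin m) → ℚ, (∀ σ, 0 < w σ) ∧
      ∀ i i', ∑ σ, w σ * (if σ i = i' then 1 else 0) = M i i' := by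
  classical
  rcases Nat.eq_zero_or_pos m with hm | hm
  · subst hm
    exact ⟨fun _ => 1, fun _ => one_pos, fun i => Fin.elim0 i⟩
  set i₀ : Fin m := ⟨0, hm⟩ with hi₀
  obtain ⟨p₀, -, hp₀⟩ := Finset.exists_min_image Finset.univ (fun p : Fin m × Fin m => M p.1 p.2)
    ⟨(i₀, i₀), Finset.mem_univ _⟩
  set μ : ℚ := M p₀.1 p₀.2 / 2 with hμ
  have hμpos : 0 < μ := by
    have := hpos p₀.1 p₀.2
    rw [hμ]; positivity
  have hμle : ∀ i i', 2 * μ ≤ M i i' := fun i i' => by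
    have := hp₀ (i, i') (Finset.mem_univ _)
    rw [hμ]; linarith
  set S : ℕ := (Finset.univ.filter fun σ : Equiv.Perm (Fin m) => σ i₀ = i₀).card with hSdef
  have hS : 0 < S := Finset.card_pos.mpr ⟨1, by simp⟩
  have hcount : ∀ i i', ∑ σ : Equiv.Perm (Fin m), (if σ i = i' then (1 : ℚ) else 0) = S := by
    intro i i'
    rw [Finset.sum_boole, hSdef, card_filter_perm_apply_eq i i' i₀ i₀]
  set sN : ℚ := 1 - m * μ with hsN
  have hsN0 : 0 ≤ sN := by
    have h : (m : ℚ) * (2 * μ) ≤ 1 := by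
      rw [← hrow i₀, show (m : ℚ) * (2 * μ) = ∑ _i' : Fin m, 2 * μ from by
        rw [Finset.sum_const, Finset.card_univ, Fintype.card_fin, nsmul_eq_mul]]
      exact Finset.sum_le_sum fun i' _ => hμle i₀ i'
    rw [hsN]; nlinarith [hμpos]
  obtain ⟨M', hM', hN⟩ :=
    (exists_mem_doublyStochastic_eq_smul_iff (M := Matrix.of fun i i' : Fin m => M i i' - μ) hsN0).mpr
      ⟨fun i i' => by rw [Matrix.of_apply]; linarith [hμle i i', hμpos],
       fun i => by
        simp only [Matrix.of_apply]
        rw [Finset.sum_sub_distrib, hrow, Finset.sum_const, Finset.card_univ, Fintype.card_fin,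
          nsmul_eq_mul],
       fun i' => by
        simp only [Matrix.of_apply]
        rw [Finset.sum_sub_distrib, hcol, Finset.sum_const, Finset.card_univ, Fintype.card_fin,
          nsmul_eq_mul]⟩
  obtain ⟨π, hπ0, -, hπM⟩ := exists_eq_sum_perm_of_mem_doublyStochastic hM'
  refine ⟨fun σ => sN * π σ + μ / S, fun σ => ?_, fun i i' => ?_⟩
  · have h1 : 0 < μ / S := by positivity
    have h2 : 0 ≤ sN * π σ := mul_nonneg hsN0 (hπ0 σ)
    linarith
  · have hentry : ∑ σ, π σ * (if σ i = i' then (1 : ℚ) else 0) = M' i i' := by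
      have h := congrFun (congrFun hπM i) i'
      rw [Matrix.sum_apply] at h
      simpa only [Matrix.smul_apply, permMatrix_apply_eq_ite, smul_eq_mul] using h
    have hNii : M i i' - μ = sN * M' i i' := by
      have h := congrFun (congrFun hN i) i'
      simpa only [Matrix.of_apply, Matrix.smul_apply, smul_eq_mul] using h
    have hS' : (S : ℚ) ≠ 0 := by exact_mod_cast hS.ne'
    calc ∑ σ : Equiv.Perm (Fin m), (sN * π σ + μ / S) * (if σ i = i' then (1 : ℚ) else 0)
        = sN * ∑ σ : Equiv.Perm (Fin m), π σ * (if σ i = i' then (1 : ℚ) else 0) +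
            μ / S * ∑ σ : Equiv.Perm (Fin m), (if σ i = i' then (1 : ℚ) else 0) := by
          rw [Finset.mul_sum, Finset.mul_sum, ← Finset.sum_add_distrib]
          exact Finset.sum_congr rfl fun τ _ => by ring
      _ = sN * M' i i' + μ / S * S := by rw [hentry, hcount]
      _ = M i i' := by rw [← hNii]; field_simp; ring

end Mixture

/-! ### 2. The flat strictly positive coupling of the residue counts -/

section FlatCoupling

variable {m j : ℕ} [NeZero j]

/-- For `j ≤ m` every residue class mod `j` meets `[0, m)` (it contains its own representative).
[folklore] -/
theorem card_filter_ofNat_pos (hjm : j ≤ m) (s : Fin j) :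
    0 < (Finset.univ.filter fun i : Fin m => Fin.ofNat j (i : ℕ) = s).card :=
  Finset.card_pos.mpr ⟨⟨s, lt_of_lt_of_le s.isLt hjm⟩, by simp⟩

/-- Every residue class mod `j` has at least `⌊m/j⌋` representatives `s, s+j, …` in `[0, m)`.
[folklore] -/
theorem div_le_card_filter_ofNat (hj : 0 < j) (s : Fin j) :
    m / j ≤ (Finset.univ.filter fun i : Fin m => Fin.ofNat j (i : ℕ) = s).card := by
  classical
  have hb : ∀ l : Fin (m / j), (s : ℕ) + l * j < m := by
    intro l
    have h1 : (s : ℕ) + l * j < (l + 1) * j := by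
      rw [add_mul, one_mul, add_comm]
      exact Nat.add_lt_add_left s.isLt _
    have h2 : ((l : ℕ) + 1) * j ≤ (m / j) * j := Nat.mul_le_mul_right j l.isLt
    exact lt_of_lt_of_le (lt_of_lt_of_le h1 h2) (Nat.div_mul_le_self m j)
  set f : Fin (m / j) → Fin m := fun l => ⟨(s : ℕ) + l * j, hb l⟩ with hf
  have hfinj : Function.Injective f := by
    intro l l' h
    have h' : (s : ℕ) + l * j = s + l' * j := by
      have := congrArg Fin.val h
      simpa [hf] using this
    exact Fin.ext (Nat.eq_of_mul_eq_mul_right hj (Nat.add_left_cancel h'))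
  have himg : Finset.univ.image f ⊆ Finset.univ.filter fun i : Fin m => Fin.ofNat j (i : ℕ) = s := by
    intro i hi
    obtain ⟨l, -, rfl⟩ := Finset.mem_image.mp hi
    simp only [Finset.mem_filter, Finset.mem_univ, true_and, hf]
    ext
    rw [Fin.val_ofNat, Nat.add_mul_mod_self_right, Nat.mod_eq_of_lt s.isLt]
  calc m / j = (Finset.univ.image f).card := by
        rw [Finset.card_image_of_injective _ hfinj, Finset.card_univ, Fintype.card_fin]
    _ ≤ _ := Finset.card_le_card himg

/-- The residue classes partition `[0, m)`: `∑_s A_s = m`. [folklore] -/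
theorem sum_card_filter_ofNat :
    ∑ s : Fin j, (Finset.univ.filter fun i : Fin m => Fin.ofNat j (i : ℕ) = s).card = m := by
  classical
  rw [← Finset.card_eq_sum_card_fiberwise (fun i _ => Finset.mem_univ (Fin.ofNat j ((i : Fin m) : ℕ)))]
  simp

/-- Fibrewise summation over the residue map: `∑_{i<m} φ(i mod j) = ∑_s A_s φ(s)`. [folklore] -/
theorem sum_comp_ofNat_eq (φ : Fin j → ℚ) :
    ∑ i : Fin m, φ (Fin.ofNat j (i : ℕ)) =
      ∑ s : Fin j, ((Finset.univ.filter fun i : Fin m => Fin.ofNat j (i : ℕ) = s).card : ℚ) * φ s := by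
  classical
  rw [← Finset.sum_fiberwise_of_maps_to (g := fun i : Fin m => Fin.ofNat j (i : ℕ))
    (fun i _ => Finset.mem_univ _)]
  refine Finset.sum_congr rfl fun s _ => ?_
  rw [Finset.sum_congr rfl fun i hi => by rw [(Finset.mem_filter.mp hi).2], Finset.sum_const,
    nsmul_eq_mul]

/-- **The flat strictly positive coupling.** For `1 ≤ j ≤ m` there is a doubly stochastic
`m × m` matrix `M` with all entries positive whose RESIDUE PROFILE is flat:
`∑_{i,i' : (i' mod j) + (i mod j) = r} M_{i i'} = m/j` for every residue `r`. Construction: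
`A_s = #{i < m : i ≡ s}`, `P_{st} = (A_s + A_t)/j - m/j²` (positive since `j(A_s+A_t) ≥ 2j⌊m/j⌋ > m`,
line sums `∑_t P_{st} = A_s`, diagonal sums `∑_s P_{s,r-s} = m/j`), `M_{ii'} = P_{ρi,ρi'}/(A_{ρi}A_{ρi'})`.
[folklore] -/
theorem exists_flat_pos_coupling (hj : 0 < j) (hjm : j ≤ m) :
    ∃ M : Matrix (Fin m) (Fin m) ℚ, (∀ i i', 0 < M i i') ∧ (∀ i, ∑ i', M i i' = 1) ∧
      (∀ i', ∑ i, M i i' = 1) ∧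
      ∀ x : Fin j, ∑ i : Fin m, ∑ i' : Fin m,
        (if Fin.ofNat j ((i' : Fin m) : ℕ) + Fin.ofNat j (i : ℕ) = x then M i i' else 0) =
          (m : ℚ) / j := by
  classical
  set A : Fin j → ℕ := fun s => (Finset.univ.filter fun i : Fin m => Fin.ofNat j (i : ℕ) = s).card
    with hA
  have hApos : ∀ s, 0 < (A s : ℚ) := fun s => by
    rw [hA]; exact_mod_cast card_filter_ofNat_pos hjm s
  have hsumA : ∑ s, (A s : ℚ) = m := by
    rw [hA]; exact_mod_cast sum_card_filter_ofNat (m := m) (j := j)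
  have hfib : ∀ φ : Fin j → ℚ, ∑ i : Fin m, φ (Fin.ofNat j (i : ℕ)) = ∑ s, (A s : ℚ) * φ s :=
    fun φ => by rw [hA]; exact sum_comp_ofNat_eq φ
  set P : Fin j → Fin j → ℚ := fun s t => ((A s : ℚ) + A t) / j - (m : ℚ) / (j : ℚ) ^ 2 with hP
  have hj' : (0 : ℚ) < j := by exact_mod_cast hj
  have hPpos : ∀ s t, 0 < P s t := by
    intro s t
    have hq : 0 < m / j := Nat.div_pos hjm hj
    have h1 := Nat.div_add_mod m j
    have h2 := Nat.mod_lt m hj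
    have hs : m / j ≤ A s := div_le_card_filter_ofNat (m := m) hj s
    have ht : m / j ≤ A t := div_le_card_filter_ofNat (m := m) hj t
    have hjq : j ≤ j * (m / j) := Nat.le_mul_of_pos_right j hq
    have hjs := Nat.mul_le_mul_left j hs
    have hjt := Nat.mul_le_mul_left j ht
    have hnat : m < j * (A s + A t) := by rw [mul_add]; omega
    have hlt : (m : ℚ) < j * ((A s : ℚ) + A t) := by exact_mod_cast hnat
    rw [hP]
    simp only
    rw [sub_pos, div_lt_div_iff₀ (by positivity) hj']
    nlinarith [hlt, hj']
  have hPsymm : ∀ s t, P s t = P t s := fun s t => by rw [hP]; simp only; rw [add_comm]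
  have hProw : ∀ s, ∑ t, P s t = A s := by
    intro s
    rw [hP]; simp only
    rw [Finset.sum_sub_distrib, ← Finset.sum_div, Finset.sum_add_distrib, Finset.sum_const,
      Finset.card_univ, Fintype.card_fin, hsumA, Finset.sum_const, Finset.card_univ, Fintype.card_fin,
      nsmul_eq_mul, nsmul_eq_mul]
    field_simp
    ring
  refine ⟨fun i i' => P (Fin.ofNat j (i : ℕ)) (Fin.ofNat j (i' : ℕ)) /
      ((A (Fin.ofNat j (i : ℕ)) : ℚ) * A (Fin.ofNat j (i' : ℕ))), fun i i' => ?_, fun i => ?_,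
    fun i' => ?_, fun x => ?_⟩
  · exact div_pos (hPpos _ _) (mul_pos (hApos _) (hApos _))
  · rw [hfib (fun t => P (Fin.ofNat j (i : ℕ)) t / ((A (Fin.ofNat j (i : ℕ)) : ℚ) * A t))]
    have : ∀ t : Fin j, (A t : ℚ) * (P (Fin.ofNat j (i : ℕ)) t / ((A (Fin.ofNat j (i : ℕ)) : ℚ) * A t)) =
        P (Fin.ofNat j (i : ℕ)) t / A (Fin.ofNat j (i : ℕ)) := by
      intro t
      have := (hApos t).ne'
      field_simp
    simp_rw [this]
    rw [← Finset.sum_div, hProw, div_self (hApos _).ne']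
  · rw [hfib (fun s => P s (Fin.ofNat j (i' : ℕ)) / ((A s : ℚ) * A (Fin.ofNat j (i' : ℕ))))]
    have : ∀ s : Fin j, (A s : ℚ) * (P s (Fin.ofNat j (i' : ℕ)) / ((A s : ℚ) * A (Fin.ofNat j (i' : ℕ)))) =
        P (Fin.ofNat j (i' : ℕ)) s / A (Fin.ofNat j (i' : ℕ)) := by
      intro s
      have := (hApos s).ne'
      rw [hPsymm s]
      field_simp
    simp_rw [this]
    rw [← Finset.sum_div, hProw, div_self (hApos _).ne']
  · -- the residue profile: inner sum over `i'` first
    have hinner : ∀ i : Fin m, ∑ i' : Fin m,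
        (if Fin.ofNat j ((i' : Fin m) : ℕ) + Fin.ofNat j (i : ℕ) = x then
          P (Fin.ofNat j (i : ℕ)) (Fin.ofNat j (i' : ℕ)) /
            ((A (Fin.ofNat j (i : ℕ)) : ℚ) * A (Fin.ofNat j (i' : ℕ))) else 0) =
        P (Fin.ofNat j (i : ℕ)) (x - Fin.ofNat j (i : ℕ)) / A (Fin.ofNat j (i : ℕ)) := by
      intro i
      rw [hfib (fun t => if t + Fin.ofNat j (i : ℕ) = x then
          P (Fin.ofNat j (i : ℕ)) t / ((A (Fin.ofNat j (i : ℕ)) : ℚ) * A t) else 0)]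
      have : ∀ t : Fin j, (A t : ℚ) * (if t + Fin.ofNat j (i : ℕ) = x then
          P (Fin.ofNat j (i : ℕ)) t / ((A (Fin.ofNat j (i : ℕ)) : ℚ) * A t) else 0) =
          if t = x - Fin.ofNat j (i : ℕ) then P (Fin.ofNat j (i : ℕ)) t / A (Fin.ofNat j (i : ℕ)) else 0 := by
        intro t
        by_cases h : t + Fin.ofNat j (i : ℕ) = x
        · rw [if_pos h, if_pos (eq_sub_of_add_eq h)]
          have := (hApos t).ne'
          field_simp
        · rw [if_neg h, if_neg (fun h' => h (by rw [h', sub_add_cancel])), mul_zero]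
      simp_rw [this]
      rw [Finset.sum_ite_eq' Finset.univ, if_pos (Finset.mem_univ _)]
    simp_rw [hinner]
    rw [hfib (fun s => P s (x - s) / A s)]
    have : ∀ s : Fin j, (A s : ℚ) * (P s (x - s) / A s) = P s (x - s) := by
      intro s
      have := (hApos s).ne'
      field_simp
    simp_rw [this]
    rw [hP]; simp only
    have hreidx : ∑ s : Fin j, (A (x - s) : ℚ) = ∑ s : Fin j, (A s : ℚ) :=
      Fintype.sum_equiv (Equiv.subLeft x) _ _ (fun s => rfl)
    rw [Finset.sum_sub_distrib, ← Finset.sum_div, Finset.sum_add_distrib, hsumA, hreidx, hsumA,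
      Finset.sum_const, Finset.card_univ, Fintype.card_fin, nsmul_eq_mul]
    field_simp
    ring

end FlatCoupling

/-! ### 3. The positive cone and polystability of `Q_{m,j}` -/

section Polystable

variable {m j : ℕ} [NeZero j]

/-- **Positive cone of exponents of the modular collapse** (hypothesis 2 of the corrected BI 2017
Prop. 2.8), for `1 ≤ j ≤ m`: there are rational `c_α > 0`, `α ∈ supp Q_{m,j}`, with
`∑_α c_α α_r = 1` for every variable `y_r`. Take the flat positive coupling `M`
(`exists_flat_pos_coupling`), positive permutation weights `w_σ` with `∑_σ w_σ [σ i = i'] = M_{ii'}`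
(`exists_pos_weights_of_pos_doublyStochastic`), and `c_α = (j/m) ∑_{e_σ = α} w_σ`: then
`∑_α c_α α_r = (j/m) ∑_σ w_σ #{i : (σ i + i) mod j = r} = (j/m) ∑_{i,i'} M_{ii'} [ρ i' + ρ i = r] = 1`.
[cite: BurgisserIkenmeyer2017, Prop. 2.8 (corrected) and Cor. 2.9 (proof)] -/
theorem modCollapse_posCone (hj : 0 < j) (hjm : j ≤ m) :
    ∃ c : (Fin j →₀ ℕ) → ℚ,
      (∀ α ∈ (MvPolynomial.rename
          (fun ik : Fin m × Fin m => Fin.ofNat j (ik.1 : ℕ) + Fin.ofNat j (ik.2 : ℕ))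
          (perPoly (Fin m) ℂ)).support, 0 < c α) ∧
      ∀ x : Fin j, ∑ α ∈ (MvPolynomial.rename
          (fun ik : Fin m × Fin m => Fin.ofNat j (ik.1 : ℕ) + Fin.ofNat j (ik.2 : ℕ))
          (perPoly (Fin m) ℂ)).support, c α * (α x : ℚ) = 1 := by
  classical
  have hm : 0 < m := lt_of_lt_of_le hj hjm
  obtain ⟨M, hMpos, hMrow, hMcol, hMflat⟩ := exists_flat_pos_coupling (m := m) hj hjm
  obtain ⟨w, hwpos, hwM⟩ := exists_pos_weights_of_pos_doublyStochastic M hMpos hMrow hMcol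
  set e : Equiv.Perm (Fin m) → (Fin j →₀ ℕ) := fun σ =>
    ∑ i : Fin m, Finsupp.single (Fin.ofNat j ((σ i : Fin m) : ℕ) + Fin.ofNat j (i : ℕ)) 1
    with hedef
  set Q := MvPolynomial.rename
          (fun ik : Fin m × Fin m => Fin.ofNat j (ik.1 : ℕ) + Fin.ofNat j (ik.2 : ℕ))
          (perPoly (Fin m) ℂ) with hQdef
  have hsupp : ∀ α, α ∈ Q.support ↔ ∃ σ, e σ = α := fun α => mem_support_modCollapse_iff α
  refine ⟨fun α => ((j : ℚ) / m) * ∑ σ ∈ Finset.univ.filter (fun σ => e σ = α), w σ, ?_, ?_⟩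
  · intro α hα
    obtain ⟨σ, hσ⟩ := (hsupp α).mp hα
    have hj' : (0 : ℚ) < j := by exact_mod_cast hj
    have hm' : (0 : ℚ) < m := by exact_mod_cast hm
    have hsum : 0 < ∑ τ ∈ Finset.univ.filter (fun τ => e τ = α), w τ :=
      Finset.sum_pos (fun τ _ => hwpos τ) ⟨σ, by simp [hσ]⟩
    positivity
  · intro x
    have hmaps : ∀ σ ∈ (Finset.univ : Finset (Equiv.Perm (Fin m))), e σ ∈ Q.support :=
      fun σ _ => (hsupp _).mpr ⟨σ, rfl⟩
    -- regroup the sum over the support as a sum over permutations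
    have key : ∑ α ∈ Q.support, (∑ σ ∈ Finset.univ.filter (fun σ => e σ = α), w σ) * (α x : ℚ) =
        ∑ σ : Equiv.Perm (Fin m), w σ * ((e σ) x : ℚ) := by
      rw [← Finset.sum_fiberwise_of_maps_to hmaps]
      refine Finset.sum_congr rfl fun α _ => ?_
      rw [Finset.sum_mul]
      exact Finset.sum_congr rfl fun σ hσ => by rw [(Finset.mem_filter.mp hσ).2]
    -- the residue content of `e_σ` at `x`
    have h1 : ∀ σ : Equiv.Perm (Fin m), ((e σ) x : ℚ) =
        ∑ i : Fin m, if Fin.ofNat j ((σ i : Fin m) : ℕ) + Fin.ofNat j (i : ℕ) = x then (1 : ℚ) else 0 := by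
      intro σ
      simp only [hedef, Finsupp.coe_finsetSum, Finset.sum_apply, Finsupp.single_apply]
      push_cast
      rfl
    -- sum over permutations with a prescribed value at `i`
    have h2 : ∀ i : Fin m, ∑ σ : Equiv.Perm (Fin m), w σ *
        (if Fin.ofNat j ((σ i : Fin m) : ℕ) + Fin.ofNat j (i : ℕ) = x then (1 : ℚ) else 0) =
        ∑ i' : Fin m, if Fin.ofNat j ((i' : Fin m) : ℕ) + Fin.ofNat j (i : ℕ) = x then M i i' else 0 := by
      intro i
      rw [← Finset.sum_fiberwise_of_maps_to (g := fun σ : Equiv.Perm (Fin m) => σ i)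
        (fun σ _ => Finset.mem_univ (σ i))]
      refine Finset.sum_congr rfl fun i' _ => ?_
      rw [Finset.sum_congr rfl fun σ hσ => by rw [(Finset.mem_filter.mp hσ).2]]
      by_cases h : Fin.ofNat j ((i' : Fin m) : ℕ) + Fin.ofNat j (i : ℕ) = x
      · simp_rw [if_pos h, mul_one]
        rw [← hwM i i', Finset.sum_filter]
        exact Finset.sum_congr rfl fun σ _ => by rw [mul_ite, mul_one, mul_zero]
      · simp_rw [if_neg h, mul_zero]
        exact Finset.sum_const_zero
    have htot : ∑ σ : Equiv.Perm (Fin m), w σ * ((e σ) x : ℚ) = (m : ℚ) / j := by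
      simp_rw [h1, Finset.mul_sum]
      rw [Finset.sum_comm]
      simp_rw [h2]
      exact hMflat x
    have hj' : (j : ℚ) ≠ 0 := by exact_mod_cast hj.ne'
    have hm' : (m : ℚ) ≠ 0 := by exact_mod_cast hm.ne'
    calc ∑ α ∈ Q.support, ((j : ℚ) / m * ∑ σ ∈ Finset.univ.filter (fun σ => e σ = α), w σ) * (α x : ℚ)
        = (j : ℚ) / m * ∑ α ∈ Q.support, (∑ σ ∈ Finset.univ.filter (fun σ => e σ = α), w σ) * (α x : ℚ) := by
          rw [Finset.mul_sum]
          exact Finset.sum_congr rfl fun α _ => by ring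
      _ = 1 := by rw [key, htot]; field_simp

/-- **The modular collapse `Q_{m,j} = per_m(x_{ik} ↦ y_{(i+k) mod j})` is polystable for every
`1 ≤ j ≤ m`**: its `SL_j`-orbit is Zariski closed — the corrected BI 2017 Prop. 2.8
(`isPolystable_of_separating_diagonalStabilizers`) fed with the primitive-root torus of
`…ModularCollapse` and the positive cone above. For `j ∣ m` this recovers the balanced monomial
`(y_0 ⋯ y_{j-1})^{m/j}` up to relabelling of the permutations; for `j ∤ m` it is new.
[cite: BurgisserIkenmeyer2017, Prop. 2.8 (corrected) and Cor. 2.9] -/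
theorem isPolystable_modCollapse (hj : 0 < j) (hjm : j ≤ m) :
    IsPolystable (MvPolynomial.rename
        (fun ik : Fin m × Fin m => Fin.ofNat j (ik.1 : ℕ) + Fin.ofNat j (ik.2 : ℕ))
        (perPoly (Fin m) ℂ)) := by
  obtain ⟨c, hcpos, hc⟩ := modCollapse_posCone (m := m) hj hjm
  exact isPolystable_of_separating_diagonalStabilizers _ modCollapse_isHomogeneous
    (fun x x' h => modCollapse_separating x x' h) c hcpos hc

end Polystable

end Summit.ValiantsHypothesis.ValiantsHypothesis.Theorems.GeneratorObstructions.PerGenDegreeSuperQP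

end
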